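import Summits.AtomisticToContinuum.Crystallization.Theses.OneCentreSteepnessLadder
import Summits.AtomisticToContinuum.Crystallization.Theorems.OneCentreSteepnessLadderDominationEnergyLimitHcp
import Summits.AtomisticToContinuum.Crystallization.Theorems.OneCentreSteepnessLadderDominationEnergyLimitSubadd
import Summits.AtomisticToContinuum.Crystallization.Theorems.OneCentreSteepnessLadderDominationEnergyLimitBlocks
import Summits.AtomisticToContinuum.Crystallization.Theorems.OneCentreSteepnessLadderDominationEnergyLimitLower

/-!
# Route `OneCentreSteepnessLadder`: item `DominationEnergyLimit` (stmt-AtomisticToContinuum-12887)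

**Theorem `dominationEnergyLimit_proof : DominationEnergyLimit`.**  For `q ≥ 4`, `δ, a, h > 0`:
existence of `V_q` ground states for every `N` (H1) + `δ`-separation of all ground states (H2) +
the one-centre domination template at `(q, δ, a, h)` (H3; only its NON-COERCIVE clause is used)
imply the energetic crystallisation conjunct `HasPeriodicGroundStateEnergy (miePotential q) 3`,
with the explicit minimiser `P = hcpPeriodicConfiguration a h`.

Proof (Blanc–Lewin 2015 §1.3/§2.3 bookkeeping; Theil 2006 for the shape of the statement):
* `e(P) = −Φ_hcp(a,h)/(4q)` (`energyPerParticle_hcp_miePotential`, HCP is vertex-transitive);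
* lower bound `E(N) ≥ N(e(P) − β)` for every `β > 0` from (H2)+(H3): transfers cancel, far field
  small (`lowerBound`);
* hence `E(N) ≥ −C N`; with (H1), strict binding makes `N ↦ E(N)` subadditive and Fekete gives
  `E(N)/N → e_∞ = inf E(N)/N` (`exists_tendsto_div_of_groundStates`); so `e_∞ ≥ e(P)`;
* blocks of ANY periodic `Q` are trial states (`exists_block_energy_le_miePotential`):
  `e_∞ ≤ E(#block)/#block ≤ e(Q) + ε`, so `e_∞ ≤ e(Q)`; with `Q = P`, `e_∞ = e(P)` is the least
  periodic energy per particle and the limit of `E(N)/N`.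
-/

noncomputable section

namespace Summit.AtomisticToContinuum.Crystallization.Theorems

open Literature.MathematicalPhysics.StatisticalMechanics
open Summit.AtomisticToContinuum.Crystallization.Theorems.DominationEnergyLimit
open Summit.AtomisticToContinuum.Crystallization.Theorems.ChargedEnergyGapNegative.Blocks
open scoped BigOperators
open Filter Topology

/-- **Item `DominationEnergyLimit` (stmt-AtomisticToContinuum-12887) of route
`OneCentreSteepnessLadder`**: for `q ≥ 4` and `δ, a, h > 0`, existence of `V_q` ground states for
all `N`, `δ`-separation of ground states and one-centre domination at `(q, δ, a, h)` imply
`HasPeriodicGroundStateEnergy (miePotential q) 3` — with minimiser the relaxed HCP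
`hcpPeriodicConfiguration a h`, `e(hcp a h) = −Φ_hcp(a,h)/(4q) = lim E(N)/N = min_Q e(Q)`.
[folklore] -/
theorem dominationEnergyLimit_proof :
    Summit.AtomisticToContinuum.Crystallization.Theses.OneCentreSteepnessLadder.DominationEnergyLimit := by
  intro q hq δ a h hδ ha hh hex hsep hdom
  have hq0 : q ≠ 0 := by omega
  have ha0 : a ≠ 0 := ha.ne'
  have hh0 : h ≠ 0 := hh.ne'
  -- the candidate value `e₀ = -Φ_hcp/(4q)`
  obtain ⟨e₀, he₀⟩ : ∃ e₀ : ℝ, e₀ =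
      -(∑' p : ↥(hcpStacking a h), (2 * (‖(p : EuclideanSpace ℝ (Fin 3))‖)⁻¹ ^ q -
        (‖(p : EuclideanSpace ℝ (Fin 3))‖)⁻¹ ^ (2 * q))) / (4 * (q : ℝ)) := ⟨_, rfl⟩
  -- (A) the energy per particle of relaxed hcp
  have hA : (hcpPeriodicConfiguration ha0 hh0).energyPerParticle (miePotential q) = e₀ := by
    rw [he₀]
    exact energyPerParticle_hcp_miePotential hq0 ha0 hh0
  -- (B) the lower bound at every ground state, from the non-coercive clause of domination
  have hlow : ∀ β : ℝ, 0 < β → ∀ (N : ℕ) (x : Fin N → EuclideanSpace ℝ (Fin 3)),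
      IsGroundState (miePotential q) x →
        (N : ℝ) * (e₀ - β) ≤ interactionEnergy (miePotential q) x := by
    intro β hβ N x hxg
    rw [he₀]
    refine lowerBound hq hδ _ ?_ hβ hxg.1 (hsep N x hxg)
    intro ε hε R₀
    obtain ⟨γ, -, hγ⟩ := hdom 1 one_pos
    obtain ⟨R, hR, g, -, hS⟩ := hγ ε hε R₀
    exact ⟨R, hR, g, fun S hS' => ⟨(hS S hS').1, fun x hx => ((hS S hS').2 x hx).1⟩⟩
  have hlowE : ∀ β : ℝ, 0 < β → ∀ N : ℕ,
      (N : ℝ) * (e₀ - β) ≤ groundStateEnergy (miePotential q) 3 N := by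
    intro β hβ N
    obtain ⟨x, hxg⟩ := hex N
    rw [← hxg.2]
    exact hlow β hβ N x hxg
  -- (C) Fekete: `E(N)/N → e` with `e ≤ E(N)/N`
  have hC : ∀ N : ℕ, 0 < N →
      -((|e₀| + 1) * (N : ℝ)) ≤ groundStateEnergy (miePotential q) 3 N := by
    intro N _
    have h1 := hlowE 1 one_pos N
    have hN : (0 : ℝ) ≤ N := Nat.cast_nonneg N
    have h2 : -((|e₀| + 1) * (N : ℝ)) ≤ (N : ℝ) * (e₀ - 1) := by
      have := neg_abs_le e₀
      nlinarith
    exact h2.trans h1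
  obtain ⟨e, htend, hle⟩ :=
    exists_tendsto_div_of_groundStates hq0 (by norm_num : 0 < 3) hex hC
  -- (D) `e₀ ≤ e`
  have he_ge : e₀ ≤ e := by
    refine le_of_forall_pos_le_add fun β hβ => ?_
    have h1 : e₀ - β ≤ e := by
      refine ge_of_tendsto htend ?_
      filter_upwards [Filter.eventually_gt_atTop 0] with N hN
      have hN' : (0 : ℝ) < N := by exact_mod_cast hN
      rw [le_div_iff₀ hN']
      have := hlowE β hβ N
      linarith
    linarith
  -- (E) `e ≤ e(Q)` for every periodic `Q`: blocks are trial states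
  have he_le : ∀ Q : PeriodicConfiguration 3, e ≤ Q.energyPerParticle (miePotential q) := by
    intro Q
    refine le_of_forall_pos_le_add fun ε hε => ?_
    obtain ⟨K₀, hK₀, hK⟩ := exists_block_energy_le_miePotential Q hq hε
    have hnpos : 0 < Fintype.card (BIdx Q K₀) := by
      rw [card_BIdx]
      exact Nat.mul_pos Q.motif_nonempty.card_pos (pow_pos hK₀ 3)
    have hn : (0 : ℝ) < Fintype.card (BIdx Q K₀) := by exact_mod_cast hnpos
    have h1 := hle _ hnpos
    have h2 : groundStateEnergy (miePotential q) 3 (Fintype.card (BIdx Q K₀)) ≤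
        interactionEnergy (miePotential q) (blockConfig Q K₀) :=
      groundStateEnergy_miePotential_le hq0 (blockConfig_injective Q K₀)
    have h3 := hK K₀ le_rfl
    rw [le_div_iff₀ hn] at h1
    nlinarith
  -- (F) conclude with `P = hcp(a, h)`
  have heP : e = (hcpPeriodicConfiguration ha0 hh0).energyPerParticle (miePotential q) :=
    le_antisymm (he_le _) (hA ▸ he_ge)
  refine ⟨hcpPeriodicConfiguration ha0 hh0, ⟨⟨hcpPeriodicConfiguration ha0 hh0, rfl⟩, ?_⟩, ?_⟩
  · rintro _ ⟨Q, rfl⟩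
    rw [← heP]
    exact he_le Q
  · rw [← heP]
    exact htend

end Summit.AtomisticToContinuum.Crystallization.Theorems

end
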